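import Literature.AlgebraicGeometry.HodgeTheory.WeilClassesFieldCMCentreMatricesDecomposable
import Literature.AlgebraicGeometry.Deligne1982.WeilSpaceDimension
import HarnessLib

/-!
# Moonen–Zarhin's dichotomy for a CM centre, verbatim on the carrier: «either all classes in `W_F` are decomposable or
# all non-zero classes in `W_F` are exceptional», and «decomposable ⟺ `θ = 0`» as an eigenvalue count
# (Moonen–Zarhin 1998, §1 Criterion (2), type 4 with `d = 1`; Milne 1999, §1)

Layer `Literature/AlgebraicGeometry/HodgeTheory`; THEOREMS ONLY — no definition, no named fact, no `sorry` (D-0026, net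
debt 0).  Assembles the seat's two halves — `WeilClassesFieldExceptionalOfCentralTorus` (g22-#1: a multiplicity
IMBALANCE `dim(V_ρ ∩ ker(ψ^* - σ)) ≠ dim(V_ρ ∩ ker(ψ'^* - σ))` for a CENTRAL `ψ` ⟹ `W_F ⊗ ℂ ⊓ 𝒟 ⊗ ℂ = ⊥`) and
`WeilClassesFieldCMCentreMatricesDecomposable` (g22-#2: BALANCE ⟹ `W_F ⊗ ℂ ≤ 𝒟 ⊗ ℂ`) — with the dimension count
`dim_ℂ (W_F ⊗ ℂ) = [F:ℚ] ≠ 0` (`Deligne1982.finrank_weilClassesField_eq_natDegree`) into the print's statements.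

## The print

B. J. J. Moonen, Yu. G. Zarhin, *Weil classes on abelian varieties*, J. reine angew. Math. **496** (1998) 83–92 =
arXiv:alg-geom/9612017 [MoonenZarhin1998WeilClasses], §1 Criterion (2) (chunk p0003 L46–L60), VERBATIM: «Let `X` be an
abelian variety with `X ∼ Y^m`, where `Y` is simple of type 1–4.  Let `F` be a subfield of `End⁰(X)` … Then either all
classes in `W_F` are decomposable or all non-zero classes in `W_F` are exceptional; this last possibility occurs precisely
in the following cases: … `Y` is of Type 4 with `d ≥ 2` or `m ≥ 2` and the map `θ : E₋ ↪ End_F(V_X) —Tr_F→ F` is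
non-zero», and (Type 4, `d = 1`, `m = 1`) «decomposable if and only if `F ⊆ E₀`».  Proof (chunk p0003 L72–L80): «… it
acts trivially on `W_F` if and only if the composition `U_E = Z(G_div) ⊂ G_div(X) ↪ Gl_F(V_Y) —det_F→ F^*` is trivial …
if and only if … `θ` … is zero.»

## Dictionary and the reading of `θ`

As in the two imported files: `E = ℚ(ψ)` for `ψ ∈ End(A)` CENTRAL (`ψ` commutes with `End(A)`; on `A^{n+1}` the diagonal
`⊕ψ` is then central in `M_{n+1}(End A)`), `R(ψ) = 0` with `R ∈ ℤ[T]` monic irreducible over `ℚ`, Rosati image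
`ψ' ∈ End(A)` (`Q_h(ψ^* x, y) = Q_h(x, ψ'^* y)`, `ψ'^* ∈ ℂ[ψ^*]`), no real place (`ker(ψ^* - σ) ∩ ker(ψ'^* - σ) = 0`);
`F = ℚ(φ)` with `φ^* ∈ ℂ[ψ^*]` (`m = 1`) or `ιₐ ≫ φ ≫ π_b = p_{ab}(ψ)` on `A^{n+1}`.  «`θ = 0`» is read as the
BALANCE `dim(V_ρ ∩ ker(ψ^* - σ)) = dim(V_ρ ∩ ker(ψ'^* - σ))` for all roots `ρ` of `P` and all `σ` (for `α = ψ - ψ'`,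
`θ(α)` at the place `ρ` is `Σ_σ (dim(V_ρ ∩ ker(ψ^*-σ)) - dim(V_ρ ∩ ker(ψ'^*-σ))) σ`; g22-#1, «Relation to the print»).

## What is proved (every complex abelian variety; `m ≠ 0`)

* `weilClassesField_ne_bot` : `W_F ⊗ ℂ ≠ ⊥` (`dim = e = deg P ≥ 1`).
* §1 (`A`, `F ⊆ E`): **`weilClassesField_le_divisorClassesSpan_iff_forall_finrank_eq_of_central`** (`W_F ≤ 𝒟ᵐ ⟺ balance`),
  **`weilClassesField_inf_divisorClassesSpan_eq_bot_iff_exists_finrank_ne_of_central`** (`W_F ⊓ 𝒟ᵐ = ⊥ ⟺ imbalance`),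
  **`weilClassesField_le_or_inf_divisorClassesSpan_eq_bot_of_central`** (THE DICHOTOMY).
* §2 (`X = A^{n+1}`, `F ⊆ M_{n+1}(E)`, product polarization; `dim A > 0`, `h^{dim A} ≠ 0`): the same three statements,
  `weilClassesField_biproduct_…`.
* §3 A SKEW GENERATOR, END-LEVEL THROUGHOUT (`…_of_central_skew`): for `ψ† = -ψ` (`Q_h(ψ^* x, y) = -Q_h(x, ψ^* y)`:
  `E = E₀(ψ)`, `ψ² ∈ E₀` totally negative — the usual presentation of a CM field) and `R(0) ≠ 0`, the Rosati image is
  `ψ' = -ψ`, there is no real place (`ker(ψ^* - σ) ∩ ker(ψ^* + σ) = 0`), and «`θ = 0`» reads: THE SPECTRUM OF `ψ^*` ON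
  EVERY `V_ρ` IS SYMMETRIC WITH MULTIPLICITIES, `dim(V_ρ ∩ ker(ψ^* - σ)) = dim(V_ρ ∩ ker(ψ^* + σ))`; iff-forms on `A`
  (`weilClassesField_le_divisorClassesSpan_iff_forall_finrank_eq_of_central_skew`,
  `weilClassesField_inf_divisorClassesSpan_eq_bot_iff_exists_finrank_ne_of_central_skew`) and on `A^{n+1}`
  (`weilClassesField_biproduct_…_of_central_skew`, with `(⊕(-ψ))^* = -(⊕ψ)^*`).  This contains the tree's
  `WeilClassesFieldExceptionalOfCentralSkewElement` (there: `p(φ^*)` central skew and a non-zero scalar on some `V_ρ` ⟹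
  exceptional — the extreme imbalance `σ ≠ 0`, `dim(V_ρ ∩ ker(T + σ)) = 0`).

Scope (honest column).  As in the imported files: type 4 with `d = 1` only (no division algebra `D ≠ E`), `ψ` central
(so that the torus of g22-#1 lies in `S(A)`), the balance a hypothesis on `H¹`; the dichotomy for types 1–3 is in the
seat's earlier rows by other mechanisms and is not restated here.

## References

* [MoonenZarhin1998WeilClasses] B. J. J. Moonen, Yu. G. Zarhin, Weil classes on abelian varieties, J. reine angew.
  Math. 496 (1998) 83–92; arXiv:alg-geom/9612017: §1 Criterion (2) and its proof (chunk p0003 L46–L90).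
* [Milne1999LefschetzClasses] J. S. Milne, Lefschetz classes on abelian varieties, Duke Math. J. 96 (1999) 639–675,
  §1 pp. 642–644, Thm. 3.2, Cor. 4.5.
* [Deligne1982HodgeCycles] P. Deligne, Hodge cycles on abelian varieties, LNM 900 (1982), §4 p. 30
  (`d[E:ℚ] = 2 dim A`; `dim W_F`).

## Provenance

Lane `lit-hodgefound` (Track 2, Layer A), prover seat `lit-hodgefound-p21` (generation 22), row g22-#3 (assembly of rows
g22-#1 and g22-#2).
-/

noncomputable section

open CategoryTheory CategoryTheory.Limits Polynomial Module
open Literature.AlgebraicTopology.SingularHomology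
open Literature.AlgebraicGeometry.Motives
open Literature.AlgebraicGeometry.VanGeemen1994 (hodgeClassSpan pullbackOne)
open Literature.AlgebraicGeometry.Milne1999
open Literature.AlgebraicGeometry.Deligne1982 (finrank_weilClassesField_eq_natDegree)
open Literature.Barriers.HodgeConjecture (divisorClassesSpan)
open Literature.Geometry.Kaehler (lefschetzPow)

namespace Literature.AlgebraicGeometry.HodgeTheory

/-! ### §0 `W_F ⊗ ℂ ≠ 0` -/

section NeBot

variable {A : AbelianVariety ℂ} {φ : A ⟶ A} {P : Polynomial ℤ} {e r : ℕ}

/-- **`W_F ⊗ ℂ ≠ 0`**: `dim_ℂ (W_F ⊗ ℂ) = e = deg P ≥ 1` («the 1-dimensional `F`-vector space `W_F`»).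
[cite: MoonenZarhin1998WeilClasses, §1 («The 1-dimensional F-vector space W_F»)] [cite: Deligne1982HodgeCycles, §4 p. 30] -/
theorem weilClassesField_ne_bot (hPe : P.natDegree = e) (hPirr : Irreducible (P.map (Int.castRingHom ℚ)))
    (hφ : Polynomial.eval₂ (Int.castRingHom (CategoryTheory.End A)) (φ : CategoryTheory.End A) P = 0)
    (her : e * r = 2 * A.dim) (hr : r ≠ 0) : weilClassesField A φ P r ≠ ⊥ := by
  intro hbot
  have hfin := finrank_weilClassesField_eq_natDegree (AbelianVariety.isSmoothProjective_holds (A := A)) φ hPe hPirr hφ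
    her hr
  rw [hbot, finrank_bot] at hfin
  have hpos : 0 < (P.map (Int.castRingHom ℚ)).natDegree := Polynomial.natDegree_pos_iff_degree_pos.2
    (Polynomial.degree_pos_of_irreducible hPirr)
  rw [Polynomial.natDegree_map_eq_of_injective (RingHom.injective_int _), hPe] at hpos
  omega

end NeBot

/-! ### §1 `A` itself, `F ⊆ E = ℚ(ψ)`, `ψ` central -/

section Subfield

variable {A : AbelianVariety ℂ} {h : complexBetti A.X 2} {φ ψ ψ' : A ⟶ A} {P R : Polynomial ℤ} {e m : ℕ}

/-- **«`W_F` decomposable ⟺ `θ = 0`» ON THE CARRIER** (MZ98 Criterion (2), type 4 with `d = 1`, `m = 1`, intrinsic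
form): for `ψ` central with `E = ℚ(ψ) ∋ ψ†` without real place and `F = ℚ(φ) ⊆ E`,
`W_F ⊗ ℂ ≤ 𝒟ᵐ ⊗ ℂ ⟺` the multiplicities of `ψ^*` and `ψ'^*` agree on every `V_ρ`.
[cite: MoonenZarhin1998WeilClasses, §1 Criterion (2) and its proof (chunk p0003 L46–L80)] [cite: Milne1999LefschetzClasses, Thm. 3.2, Cor. 4.5] -/
theorem weilClassesField_le_divisorClassesSpan_iff_forall_finrank_eq_of_central (hPm : P.Monic) (hPe : P.natDegree = e)
    (hPirr : Irreducible (P.map (Int.castRingHom ℚ)))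
    (hφ : Polynomial.eval₂ (Int.castRingHom (CategoryTheory.End A)) (φ : CategoryTheory.End A) P = 0)
    (her : e * (2 * m) = 2 * A.dim) (hm : m ≠ 0) (hh : h ∈ hodgeClassSpan A.dim A.X 1)
    (hnd : ∀ x : complexBetti A.X 1, (∀ y, polarizationPairingOne A.X h (A.dim - 1) x y = 0) → x = 0)
    (hψC : pullbackOne A ψ ∈ centralizerAlgebra A) (hRm : R.Monic) (hRirr : Irreducible (R.map (Int.castRingHom ℚ)))
    (hψR : Polynomial.eval₂ (Int.castRingHom (CategoryTheory.End A)) (ψ : CategoryTheory.End A) R = 0)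
    (hψ' : pullbackOne A ψ' ∈ Algebra.adjoin ℂ ({pullbackOne A ψ} : Set (Module.End ℂ (complexBetti A.X 1))))
    (hadj : ∀ x y : complexBetti A.X 1, polarizationPairingOne A.X h (A.dim - 1) (pullbackOne A ψ x) y =
      polarizationPairingOne A.X h (A.dim - 1) x (pullbackOne A ψ' y))
    (hCM : ∀ σ : ℂ, (pullbackOne A ψ).eigenspace σ ⊓ (pullbackOne A ψ').eigenspace σ = ⊥)
    (hF : pullbackOne A φ ∈ Algebra.adjoin ℂ ({pullbackOne A ψ} : Set (Module.End ℂ (complexBetti A.X 1)))) :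
    weilClassesField A φ P (2 * m) ≤ divisorClassesSpan A.X A.dim m ↔
      ∀ ρ : ℂ, Polynomial.eval₂ (Int.castRingHom ℂ) ρ P = 0 → ∀ σ : ℂ,
        Module.finrank ℂ ↥((pullbackOne A φ).eigenspace ρ ⊓ (pullbackOne A ψ).eigenspace σ) =
          Module.finrank ℂ ↥((pullbackOne A φ).eigenspace ρ ⊓ (pullbackOne A ψ').eigenspace σ) := by
  refine ⟨fun hle ρ hρ σ ↦ ?_, fun hbal ↦ weilClassesField_le_divisorClassesSpan_of_mem_adjoin_of_forall_finrank_eq hPm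
    hPe hPirr hφ her hh hnd hRm hRirr hψR hψ' hadj hCM hF hbal⟩
  by_contra hne
  have hbot := weilClassesField_inf_divisorClassesSpan_eq_bot_of_central_of_finrank_ne hPm hPe hPirr hφ her hm hh hnd
    hψC hRirr hψR hψ' hadj hρ hne
  rw [inf_eq_left.2 hle] at hbot
  exact weilClassesField_ne_bot hPe hPirr hφ her (Nat.mul_ne_zero two_ne_zero hm) hbot

/-- **«all non-zero classes in `W_F` are exceptional ⟺ `θ ≠ 0`» ON THE CARRIER**: under the same hypotheses,
`W_F ⊗ ℂ ⊓ 𝒟ᵐ ⊗ ℂ = ⊥ ⟺` some multiplicity of `ψ^*` and `ψ'^*` on some `V_ρ` differ.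
[cite: MoonenZarhin1998WeilClasses, §1 Criterion (2) and its proof (chunk p0003 L46–L80)] [cite: Milne1999LefschetzClasses, Thm. 3.2, Cor. 4.5] -/
theorem weilClassesField_inf_divisorClassesSpan_eq_bot_iff_exists_finrank_ne_of_central (hPm : P.Monic)
    (hPe : P.natDegree = e) (hPirr : Irreducible (P.map (Int.castRingHom ℚ)))
    (hφ : Polynomial.eval₂ (Int.castRingHom (CategoryTheory.End A)) (φ : CategoryTheory.End A) P = 0)
    (her : e * (2 * m) = 2 * A.dim) (hm : m ≠ 0) (hh : h ∈ hodgeClassSpan A.dim A.X 1)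
    (hnd : ∀ x : complexBetti A.X 1, (∀ y, polarizationPairingOne A.X h (A.dim - 1) x y = 0) → x = 0)
    (hψC : pullbackOne A ψ ∈ centralizerAlgebra A) (hRm : R.Monic) (hRirr : Irreducible (R.map (Int.castRingHom ℚ)))
    (hψR : Polynomial.eval₂ (Int.castRingHom (CategoryTheory.End A)) (ψ : CategoryTheory.End A) R = 0)
    (hψ' : pullbackOne A ψ' ∈ Algebra.adjoin ℂ ({pullbackOne A ψ} : Set (Module.End ℂ (complexBetti A.X 1))))
    (hadj : ∀ x y : complexBetti A.X 1, polarizationPairingOne A.X h (A.dim - 1) (pullbackOne A ψ x) y =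
      polarizationPairingOne A.X h (A.dim - 1) x (pullbackOne A ψ' y))
    (hCM : ∀ σ : ℂ, (pullbackOne A ψ).eigenspace σ ⊓ (pullbackOne A ψ').eigenspace σ = ⊥)
    (hF : pullbackOne A φ ∈ Algebra.adjoin ℂ ({pullbackOne A ψ} : Set (Module.End ℂ (complexBetti A.X 1)))) :
    weilClassesField A φ P (2 * m) ⊓ divisorClassesSpan A.X A.dim m = ⊥ ↔
      ∃ ρ σ : ℂ, Polynomial.eval₂ (Int.castRingHom ℂ) ρ P = 0 ∧
        Module.finrank ℂ ↥((pullbackOne A φ).eigenspace ρ ⊓ (pullbackOne A ψ).eigenspace σ) ≠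
          Module.finrank ℂ ↥((pullbackOne A φ).eigenspace ρ ⊓ (pullbackOne A ψ').eigenspace σ) := by
  refine ⟨fun hbot ↦ ?_, fun ⟨ρ, σ, hρ, hne⟩ ↦ weilClassesField_inf_divisorClassesSpan_eq_bot_of_central_of_finrank_ne hPm
    hPe hPirr hφ her hm hh hnd hψC hRirr hψR hψ' hadj hρ hne⟩
  by_contra hall
  push Not at hall
  have hle := weilClassesField_le_divisorClassesSpan_of_mem_adjoin_of_forall_finrank_eq hPm hPe hPirr hφ her hh hnd hRm
    hRirr hψR hψ' hadj hCM hF fun ρ hρ σ ↦ hall ρ σ hρ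
  rw [inf_eq_left.2 hle] at hbot
  exact weilClassesField_ne_bot hPe hPirr hφ her (Nat.mul_ne_zero two_ne_zero hm) hbot

/-- **THE DICHOTOMY «either all classes in `W_F` are decomposable or all non-zero classes in `W_F` are exceptional»**, on
the carrier, for `F ⊆ E = ℚ(ψ)`, `ψ` central with `ψ† ∈ E` and no real place.
[cite: MoonenZarhin1998WeilClasses, §1 Criterion (2) (chunk p0003 L46–L60)] -/
theorem weilClassesField_le_or_inf_divisorClassesSpan_eq_bot_of_central (hPm : P.Monic) (hPe : P.natDegree = e)
    (hPirr : Irreducible (P.map (Int.castRingHom ℚ)))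
    (hφ : Polynomial.eval₂ (Int.castRingHom (CategoryTheory.End A)) (φ : CategoryTheory.End A) P = 0)
    (her : e * (2 * m) = 2 * A.dim) (hm : m ≠ 0) (hh : h ∈ hodgeClassSpan A.dim A.X 1)
    (hnd : ∀ x : complexBetti A.X 1, (∀ y, polarizationPairingOne A.X h (A.dim - 1) x y = 0) → x = 0)
    (hψC : pullbackOne A ψ ∈ centralizerAlgebra A) (hRm : R.Monic) (hRirr : Irreducible (R.map (Int.castRingHom ℚ)))
    (hψR : Polynomial.eval₂ (Int.castRingHom (CategoryTheory.End A)) (ψ : CategoryTheory.End A) R = 0)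
    (hψ' : pullbackOne A ψ' ∈ Algebra.adjoin ℂ ({pullbackOne A ψ} : Set (Module.End ℂ (complexBetti A.X 1))))
    (hadj : ∀ x y : complexBetti A.X 1, polarizationPairingOne A.X h (A.dim - 1) (pullbackOne A ψ x) y =
      polarizationPairingOne A.X h (A.dim - 1) x (pullbackOne A ψ' y))
    (hCM : ∀ σ : ℂ, (pullbackOne A ψ).eigenspace σ ⊓ (pullbackOne A ψ').eigenspace σ = ⊥)
    (hF : pullbackOne A φ ∈ Algebra.adjoin ℂ ({pullbackOne A ψ} : Set (Module.End ℂ (complexBetti A.X 1)))) :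
    weilClassesField A φ P (2 * m) ≤ divisorClassesSpan A.X A.dim m ∨
      weilClassesField A φ P (2 * m) ⊓ divisorClassesSpan A.X A.dim m = ⊥ := by
  by_cases hbal : ∀ ρ : ℂ, Polynomial.eval₂ (Int.castRingHom ℂ) ρ P = 0 → ∀ σ : ℂ,
      Module.finrank ℂ ↥((pullbackOne A φ).eigenspace ρ ⊓ (pullbackOne A ψ).eigenspace σ) =
        Module.finrank ℂ ↥((pullbackOne A φ).eigenspace ρ ⊓ (pullbackOne A ψ').eigenspace σ)
  · exact Or.inl (weilClassesField_le_divisorClassesSpan_of_mem_adjoin_of_forall_finrank_eq hPm hPe hPirr hφ her hh hnd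
      hRm hRirr hψR hψ' hadj hCM hF hbal)
  · push Not at hbal
    obtain ⟨ρ, hρ, σ, hne⟩ := hbal
    exact Or.inr (weilClassesField_inf_divisorClassesSpan_eq_bot_of_central_of_finrank_ne hPm hPe hPirr hφ her hm hh hnd
      hψC hRirr hψR hψ' hadj hρ hne)

end Subfield

/-! ### §2 Powers `X = A^{n+1}`, `F ⊆ M_{n+1}(E)` -/

section Powers

variable {A : AbelianVariety ℂ} {h : complexBetti A.X 2} {n : ℕ} {ψ ψ' : A ⟶ A}
  {φ : ⨁ (fun _ : Fin (n + 1) => A) ⟶ ⨁ (fun _ : Fin (n + 1) => A)} {P R : Polynomial ℤ} {e m : ℕ}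

/-- **«`W_F` decomposable ⟺ `θ = 0`» FOR `X = A^{n+1}`, `F ⊆ M_{n+1}(E)`** (MZ98 Criterion (2), type 4 with `d = 1`,
`m ≥ 1`, intrinsic form), on the carrier with the product polarization.
[cite: MoonenZarhin1998WeilClasses, §1 Criterion (2) and its proof (chunk p0003 L46–L80)] [cite: Milne1999LefschetzClasses, §1 p. 643, Thm. 3.2, Cor. 4.5] -/
theorem weilClassesField_biproduct_le_divisorClassesSpan_iff_forall_finrank_eq_of_central (hA : 0 < A.dim)
    (hh : h ∈ hodgeClassSpan A.dim A.X 1) (htop : lefschetzPow h (A.dim - 1) 2 h ≠ 0)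
    (hnd : ∀ x : complexBetti A.X 1, (∀ y, polarizationPairingOne A.X h (A.dim - 1) x y = 0) → x = 0)
    (hψ : ∀ χ : A ⟶ A, ψ ≫ χ = χ ≫ ψ) (hRm : R.Monic) (hRirr : Irreducible (R.map (Int.castRingHom ℚ)))
    (hψR : Polynomial.eval₂ (Int.castRingHom (CategoryTheory.End A)) (ψ : CategoryTheory.End A) R = 0)
    (hψ' : pullbackOne A ψ' ∈ Algebra.adjoin ℂ ({pullbackOne A ψ} : Set (Module.End ℂ (complexBetti A.X 1))))
    (hadj : ∀ x y : complexBetti A.X 1, polarizationPairingOne A.X h (A.dim - 1) (pullbackOne A ψ x) y =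
      polarizationPairingOne A.X h (A.dim - 1) x (pullbackOne A ψ' y))
    (hCM : ∀ σ : ℂ, (pullbackOne A ψ).eigenspace σ ⊓ (pullbackOne A ψ').eigenspace σ = ⊥)
    (hPm : P.Monic) (hPe : P.natDegree = e) (hPirr : Irreducible (P.map (Int.castRingHom ℚ)))
    (hφ : Polynomial.eval₂ (Int.castRingHom (CategoryTheory.End (⨁ (fun _ : Fin (n + 1) => A))))
      (φ : CategoryTheory.End (⨁ (fun _ : Fin (n + 1) => A))) P = 0)
    (her : e * (2 * m) = 2 * ((n + 1) * A.dim)) (hm : m ≠ 0) (p : Fin (n + 1) → Fin (n + 1) → Polynomial ℤ)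
    (hφp : ∀ a b, biproduct.ι (fun _ : Fin (n + 1) => A) a ≫ φ ≫ biproduct.π (fun _ : Fin (n + 1) => A) b =
      Polynomial.eval₂ (Int.castRingHom (CategoryTheory.End A)) (ψ : CategoryTheory.End A) (p a b)) :
    weilClassesField (⨁ (fun _ : Fin (n + 1) => A)) φ P (2 * m) ≤
        divisorClassesSpan (⨁ (fun _ : Fin (n + 1) => A)).X (⨁ (fun _ : Fin (n + 1) => A)).dim m ↔
      ∀ ρ : ℂ, Polynomial.eval₂ (Int.castRingHom ℂ) ρ P = 0 → ∀ σ : ℂ,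
        Module.finrank ℂ ↥((pullbackOne (⨁ (fun _ : Fin (n + 1) => A)) φ).eigenspace ρ ⊓
          (pullbackOne (⨁ (fun _ : Fin (n + 1) => A)) (biproduct.map fun _ : Fin (n + 1) => ψ)).eigenspace σ) =
        Module.finrank ℂ ↥((pullbackOne (⨁ (fun _ : Fin (n + 1) => A)) φ).eigenspace ρ ⊓
          (pullbackOne (⨁ (fun _ : Fin (n + 1) => A)) (biproduct.map fun _ : Fin (n + 1) => ψ')).eigenspace σ) := by
  have herX : e * (2 * m) = 2 * (⨁ (fun _ : Fin (n + 1) => A)).dim := by rw [dim_biproduct_const_succ A n, her]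
  refine ⟨fun hle ρ hρ σ ↦ ?_, fun hbal ↦
    weilClassesField_biproduct_le_divisorClassesSpan_of_entry_eq_eval₂_of_forall_finrank_eq hA hh htop hnd hRm hRirr hψR
      hψ' hadj hCM hPm hPe hPirr hφ her p hφp hbal⟩
  by_contra hne
  have hbot := weilClassesField_biproduct_inf_divisorClassesSpan_eq_bot_of_central_of_finrank_ne hA hh htop hnd hψ hRirr
    hψR hψ' hadj hPm hPe hPirr hφ her hm hρ hne
  rw [inf_eq_left.2 hle] at hbot
  exact weilClassesField_ne_bot hPe hPirr hφ herX (Nat.mul_ne_zero two_ne_zero hm) hbot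

/-- **«all non-zero classes exceptional ⟺ `θ ≠ 0`» FOR `X = A^{n+1}`**, on the carrier.
[cite: MoonenZarhin1998WeilClasses, §1 Criterion (2) and its proof (chunk p0003 L46–L80)] [cite: Milne1999LefschetzClasses, §1 p. 643, Thm. 3.2, Cor. 4.5] -/
theorem weilClassesField_biproduct_inf_divisorClassesSpan_eq_bot_iff_exists_finrank_ne_of_central (hA : 0 < A.dim)
    (hh : h ∈ hodgeClassSpan A.dim A.X 1) (htop : lefschetzPow h (A.dim - 1) 2 h ≠ 0)
    (hnd : ∀ x : complexBetti A.X 1, (∀ y, polarizationPairingOne A.X h (A.dim - 1) x y = 0) → x = 0)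
    (hψ : ∀ χ : A ⟶ A, ψ ≫ χ = χ ≫ ψ) (hRm : R.Monic) (hRirr : Irreducible (R.map (Int.castRingHom ℚ)))
    (hψR : Polynomial.eval₂ (Int.castRingHom (CategoryTheory.End A)) (ψ : CategoryTheory.End A) R = 0)
    (hψ' : pullbackOne A ψ' ∈ Algebra.adjoin ℂ ({pullbackOne A ψ} : Set (Module.End ℂ (complexBetti A.X 1))))
    (hadj : ∀ x y : complexBetti A.X 1, polarizationPairingOne A.X h (A.dim - 1) (pullbackOne A ψ x) y =
      polarizationPairingOne A.X h (A.dim - 1) x (pullbackOne A ψ' y))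
    (hCM : ∀ σ : ℂ, (pullbackOne A ψ).eigenspace σ ⊓ (pullbackOne A ψ').eigenspace σ = ⊥)
    (hPm : P.Monic) (hPe : P.natDegree = e) (hPirr : Irreducible (P.map (Int.castRingHom ℚ)))
    (hφ : Polynomial.eval₂ (Int.castRingHom (CategoryTheory.End (⨁ (fun _ : Fin (n + 1) => A))))
      (φ : CategoryTheory.End (⨁ (fun _ : Fin (n + 1) => A))) P = 0)
    (her : e * (2 * m) = 2 * ((n + 1) * A.dim)) (hm : m ≠ 0) (p : Fin (n + 1) → Fin (n + 1) → Polynomial ℤ)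
    (hφp : ∀ a b, biproduct.ι (fun _ : Fin (n + 1) => A) a ≫ φ ≫ biproduct.π (fun _ : Fin (n + 1) => A) b =
      Polynomial.eval₂ (Int.castRingHom (CategoryTheory.End A)) (ψ : CategoryTheory.End A) (p a b)) :
    weilClassesField (⨁ (fun _ : Fin (n + 1) => A)) φ P (2 * m) ⊓
        divisorClassesSpan (⨁ (fun _ : Fin (n + 1) => A)).X (⨁ (fun _ : Fin (n + 1) => A)).dim m = ⊥ ↔
      ∃ ρ σ : ℂ, Polynomial.eval₂ (Int.castRingHom ℂ) ρ P = 0 ∧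
        Module.finrank ℂ ↥((pullbackOne (⨁ (fun _ : Fin (n + 1) => A)) φ).eigenspace ρ ⊓
          (pullbackOne (⨁ (fun _ : Fin (n + 1) => A)) (biproduct.map fun _ : Fin (n + 1) => ψ)).eigenspace σ) ≠
        Module.finrank ℂ ↥((pullbackOne (⨁ (fun _ : Fin (n + 1) => A)) φ).eigenspace ρ ⊓
          (pullbackOne (⨁ (fun _ : Fin (n + 1) => A)) (biproduct.map fun _ : Fin (n + 1) => ψ')).eigenspace σ) := by
  have herX : e * (2 * m) = 2 * (⨁ (fun _ : Fin (n + 1) => A)).dim := by rw [dim_biproduct_const_succ A n, her]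
  refine ⟨fun hbot ↦ ?_, fun ⟨ρ, σ, hρ, hne⟩ ↦
    weilClassesField_biproduct_inf_divisorClassesSpan_eq_bot_of_central_of_finrank_ne hA hh htop hnd hψ hRirr hψR hψ' hadj
      hPm hPe hPirr hφ her hm hρ hne⟩
  by_contra hall
  push Not at hall
  have hle := weilClassesField_biproduct_le_divisorClassesSpan_of_entry_eq_eval₂_of_forall_finrank_eq hA hh htop hnd hRm
    hRirr hψR hψ' hadj hCM hPm hPe hPirr hφ her p hφp fun ρ hρ σ ↦ hall ρ σ hρ
  rw [inf_eq_left.2 hle] at hbot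
  exact weilClassesField_ne_bot hPe hPirr hφ herX (Nat.mul_ne_zero two_ne_zero hm) hbot

/-- **THE DICHOTOMY FOR `X = A^{n+1}`, `F ⊆ M_{n+1}(E)`**: «either all classes in `W_F` are decomposable or all non-zero
classes in `W_F` are exceptional». [cite: MoonenZarhin1998WeilClasses, §1 Criterion (2) (chunk p0003 L46–L60)] -/
theorem weilClassesField_biproduct_le_or_inf_divisorClassesSpan_eq_bot_of_central (hA : 0 < A.dim)
    (hh : h ∈ hodgeClassSpan A.dim A.X 1) (htop : lefschetzPow h (A.dim - 1) 2 h ≠ 0)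
    (hnd : ∀ x : complexBetti A.X 1, (∀ y, polarizationPairingOne A.X h (A.dim - 1) x y = 0) → x = 0)
    (hψ : ∀ χ : A ⟶ A, ψ ≫ χ = χ ≫ ψ) (hRm : R.Monic) (hRirr : Irreducible (R.map (Int.castRingHom ℚ)))
    (hψR : Polynomial.eval₂ (Int.castRingHom (CategoryTheory.End A)) (ψ : CategoryTheory.End A) R = 0)
    (hψ' : pullbackOne A ψ' ∈ Algebra.adjoin ℂ ({pullbackOne A ψ} : Set (Module.End ℂ (complexBetti A.X 1))))
    (hadj : ∀ x y : complexBetti A.X 1, polarizationPairingOne A.X h (A.dim - 1) (pullbackOne A ψ x) y =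
      polarizationPairingOne A.X h (A.dim - 1) x (pullbackOne A ψ' y))
    (hCM : ∀ σ : ℂ, (pullbackOne A ψ).eigenspace σ ⊓ (pullbackOne A ψ').eigenspace σ = ⊥)
    (hPm : P.Monic) (hPe : P.natDegree = e) (hPirr : Irreducible (P.map (Int.castRingHom ℚ)))
    (hφ : Polynomial.eval₂ (Int.castRingHom (CategoryTheory.End (⨁ (fun _ : Fin (n + 1) => A))))
      (φ : CategoryTheory.End (⨁ (fun _ : Fin (n + 1) => A))) P = 0)
    (her : e * (2 * m) = 2 * ((n + 1) * A.dim)) (hm : m ≠ 0) (p : Fin (n + 1) → Fin (n + 1) → Polynomial ℤ)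
    (hφp : ∀ a b, biproduct.ι (fun _ : Fin (n + 1) => A) a ≫ φ ≫ biproduct.π (fun _ : Fin (n + 1) => A) b =
      Polynomial.eval₂ (Int.castRingHom (CategoryTheory.End A)) (ψ : CategoryTheory.End A) (p a b)) :
    weilClassesField (⨁ (fun _ : Fin (n + 1) => A)) φ P (2 * m) ≤
        divisorClassesSpan (⨁ (fun _ : Fin (n + 1) => A)).X (⨁ (fun _ : Fin (n + 1) => A)).dim m ∨
      weilClassesField (⨁ (fun _ : Fin (n + 1) => A)) φ P (2 * m) ⊓
        divisorClassesSpan (⨁ (fun _ : Fin (n + 1) => A)).X (⨁ (fun _ : Fin (n + 1) => A)).dim m = ⊥ := by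
  by_cases hbal : ∀ ρ : ℂ, Polynomial.eval₂ (Int.castRingHom ℂ) ρ P = 0 → ∀ σ : ℂ,
      Module.finrank ℂ ↥((pullbackOne (⨁ (fun _ : Fin (n + 1) => A)) φ).eigenspace ρ ⊓
        (pullbackOne (⨁ (fun _ : Fin (n + 1) => A)) (biproduct.map fun _ : Fin (n + 1) => ψ)).eigenspace σ) =
      Module.finrank ℂ ↥((pullbackOne (⨁ (fun _ : Fin (n + 1) => A)) φ).eigenspace ρ ⊓
        (pullbackOne (⨁ (fun _ : Fin (n + 1) => A)) (biproduct.map fun _ : Fin (n + 1) => ψ')).eigenspace σ)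
  · exact Or.inl (weilClassesField_biproduct_le_divisorClassesSpan_of_entry_eq_eval₂_of_forall_finrank_eq hA hh htop hnd
      hRm hRirr hψR hψ' hadj hCM hPm hPe hPirr hφ her p hφp hbal)
  · push Not at hbal
    obtain ⟨ρ, hρ, σ, hne⟩ := hbal
    exact Or.inr (weilClassesField_biproduct_inf_divisorClassesSpan_eq_bot_of_central_of_finrank_ne hA hh htop hnd hψ
      hRirr hψR hψ' hadj hPm hPe hPirr hφ her hm hρ hne)

end Powers

/-! ### §3 A skew generator `ψ† = -ψ`: everything at the level of `End(A)` -/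

section Skew

variable {A : AbelianVariety ℂ} {h : complexBetti A.X 2} {φ ψ : A ⟶ A} {P R : Polynomial ℤ} {e m : ℕ}

/-- `ker(-T - σ) = ker(T + σ)`. [folklore] -/
private theorem eigenspace_neg_eq_eigenspace_neg {V : Type*} [AddCommGroup V] [Module ℂ V] (T : Module.End ℂ V) (σ : ℂ) :
    (-T).eigenspace σ = T.eigenspace (-σ) := by
  ext x
  rw [Module.End.mem_eigenspace_iff, Module.End.mem_eigenspace_iff, LinearMap.neg_apply, neg_eq_iff_eq_neg, neg_smul]

/-- **No real place for a skew generator**: if `R(T) = 0` with `R(0) ≠ 0` then `ker(T - σ) ∩ ker(T + σ) = 0` for every `σ`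
(`σ = -σ` forces `σ = 0`, and `T` is injective). [folklore] -/
private theorem inf_eigenspace_neg_eq_bot_of_aeval_eq_zero {V : Type*} [AddCommGroup V] [Module ℂ V] {T : Module.End ℂ V}
    (hR0 : R.eval 0 ≠ 0) (hTR : aeval T (R.map (Int.castRingHom ℂ)) = 0) (σ : ℂ) :
    T.eigenspace σ ⊓ (-T).eigenspace σ = ⊥ := by
  rw [eigenspace_neg_eq_eigenspace_neg, Submodule.eq_bot_iff]
  rintro x ⟨hx, hx'⟩
  rw [SetLike.mem_coe, Module.End.mem_eigenspace_iff] at hx hx'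
  by_contra hx0
  have hσ : σ = 0 := by
    have e1 : (σ + σ) • x = 0 := by rw [add_smul]; nth_rw 1 [← hx]; rw [hx', neg_smul, neg_add_cancel]
    rcases smul_eq_zero.1 e1 with h2 | h2
    · linear_combination h2 / 2
    · exact absurd h2 hx0
  rw [hσ, zero_smul] at hx
  have hev : Module.End.HasEigenvector T 0 x := Module.End.hasEigenvector_iff.2
    ⟨by rw [Module.End.mem_eigenspace_iff, hx, zero_smul], hx0⟩
  have e2 := Module.End.aeval_apply_of_hasEigenvector (p := R.map (Int.castRingHom ℂ)) hev
  rw [hTR, LinearMap.zero_apply, Polynomial.eval_map, Polynomial.eval₂_at_zero, Polynomial.coeff_zero_eq_eval_zero] at e2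
  rcases smul_eq_zero.1 e2.symm with h3 | h3
  · rw [eq_intCast, Int.cast_eq_zero] at h3
    exact hR0 h3
  · exact hx0 h3

/-- `(⊕(-ψ))^* = -(⊕ψ)^*` on `H¹(A^{n+1})`. [cite: LangeBirkenhake1992, §1.1] -/
private theorem pullbackOne_biproductMap_const_neg {n : ℕ} (ψ : A ⟶ A) :
    pullbackOne (⨁ (fun _ : Fin (n + 1) => A)) (biproduct.map fun _ : Fin (n + 1) => -ψ) =
      -pullbackOne (⨁ (fun _ : Fin (n + 1) => A)) (biproduct.map fun _ : Fin (n + 1) => ψ) := by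
  refine LinearMap.ext fun v ↦ ?_
  rw [LinearMap.neg_apply, pullbackOne_biproductMap_const_apply, pullbackOne_biproductMap_const_apply,
    ← Finset.sum_neg_distrib]
  exact Finset.sum_congr rfl fun i _ ↦ by rw [pullbackOne_neg_eq_neg, LinearMap.neg_apply, map_neg]

/-- **«`W_F` decomposable ⟺ the spectrum of `ψ^*` on every `V_ρ` is symmetric», `F ⊆ E = ℚ(ψ)` on `A`** — Criterion (2),
type 4 with `d = 1`, for a central SKEW generator `ψ` (`ψ† = -ψ`, `R(ψ) = 0` irreducible over `ℚ`, `R(0) ≠ 0`), `m ≠ 0`: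
`W_F ⊗ ℂ ≤ 𝒟ᵐ ⊗ ℂ ⟺ dim(V_ρ ∩ ker(ψ^* - σ)) = dim(V_ρ ∩ ker(ψ^* + σ))` for all roots `ρ` of `P` and all `σ`.
[cite: MoonenZarhin1998WeilClasses, §1 Criterion (2) and its proof (chunk p0003 L46–L80)] [cite: Milne1999LefschetzClasses, Thm. 3.2, Cor. 4.5] -/
theorem weilClassesField_le_divisorClassesSpan_iff_forall_finrank_eq_of_central_skew (hPm : P.Monic)
    (hPe : P.natDegree = e) (hPirr : Irreducible (P.map (Int.castRingHom ℚ)))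
    (hφ : Polynomial.eval₂ (Int.castRingHom (CategoryTheory.End A)) (φ : CategoryTheory.End A) P = 0)
    (her : e * (2 * m) = 2 * A.dim) (hm : m ≠ 0) (hh : h ∈ hodgeClassSpan A.dim A.X 1)
    (hnd : ∀ x : complexBetti A.X 1, (∀ y, polarizationPairingOne A.X h (A.dim - 1) x y = 0) → x = 0)
    (hψC : pullbackOne A ψ ∈ centralizerAlgebra A) (hRm : R.Monic) (hRirr : Irreducible (R.map (Int.castRingHom ℚ)))
    (hR0 : R.eval 0 ≠ 0)
    (hψR : Polynomial.eval₂ (Int.castRingHom (CategoryTheory.End A)) (ψ : CategoryTheory.End A) R = 0)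
    (hskew : ∀ x y : complexBetti A.X 1, polarizationPairingOne A.X h (A.dim - 1) (pullbackOne A ψ x) y =
      -polarizationPairingOne A.X h (A.dim - 1) x (pullbackOne A ψ y))
    (hF : pullbackOne A φ ∈ Algebra.adjoin ℂ ({pullbackOne A ψ} : Set (Module.End ℂ (complexBetti A.X 1)))) :
    weilClassesField A φ P (2 * m) ≤ divisorClassesSpan A.X A.dim m ↔
      ∀ ρ : ℂ, Polynomial.eval₂ (Int.castRingHom ℂ) ρ P = 0 → ∀ σ : ℂ,
        Module.finrank ℂ ↥((pullbackOne A φ).eigenspace ρ ⊓ (pullbackOne A ψ).eigenspace σ) =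
          Module.finrank ℂ ↥((pullbackOne A φ).eigenspace ρ ⊓ (pullbackOne A ψ).eigenspace (-σ)) := by
  have hneg : pullbackOne A (-ψ) = -pullbackOne A ψ := pullbackOne_neg_eq_neg ψ
  have hψ' : pullbackOne A (-ψ) ∈ Algebra.adjoin ℂ ({pullbackOne A ψ} : Set (Module.End ℂ (complexBetti A.X 1))) := by
    rw [hneg]
    exact Subalgebra.neg_mem _ (Algebra.self_mem_adjoin_singleton ℂ _)
  have hadj : ∀ x y : complexBetti A.X 1, polarizationPairingOne A.X h (A.dim - 1) (pullbackOne A ψ x) y =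
      polarizationPairingOne A.X h (A.dim - 1) x (pullbackOne A (-ψ) y) := fun x y ↦ by
    rw [hneg, LinearMap.neg_apply, map_neg]
    exact hskew x y
  have hCM : ∀ σ : ℂ, (pullbackOne A ψ).eigenspace σ ⊓ (pullbackOne A (-ψ)).eigenspace σ = ⊥ := fun σ ↦ by
    rw [hneg]
    exact inf_eigenspace_neg_eq_bot_of_aeval_eq_zero hR0 (aeval_hom_complexBetti_map_one_eq_zero hψR) σ
  rw [weilClassesField_le_divisorClassesSpan_iff_forall_finrank_eq_of_central hPm hPe hPirr hφ her hm hh hnd hψC hRm hRirr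
    hψR hψ' hadj hCM hF]
  refine forall_congr' fun ρ ↦ forall_congr' fun _ ↦ forall_congr' fun σ ↦ ?_
  rw [hneg, eigenspace_neg_eq_eigenspace_neg]

/-- **«all non-zero classes in `W_F` exceptional ⟺ the spectrum of `ψ^*` on some `V_ρ` is asymmetric»**, skew form on `A`.
[cite: MoonenZarhin1998WeilClasses, §1 Criterion (2) and its proof (chunk p0003 L46–L80)] [cite: Milne1999LefschetzClasses, Thm. 3.2, Cor. 4.5] -/
theorem weilClassesField_inf_divisorClassesSpan_eq_bot_iff_exists_finrank_ne_of_central_skew (hPm : P.Monic)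
    (hPe : P.natDegree = e) (hPirr : Irreducible (P.map (Int.castRingHom ℚ)))
    (hφ : Polynomial.eval₂ (Int.castRingHom (CategoryTheory.End A)) (φ : CategoryTheory.End A) P = 0)
    (her : e * (2 * m) = 2 * A.dim) (hm : m ≠ 0) (hh : h ∈ hodgeClassSpan A.dim A.X 1)
    (hnd : ∀ x : complexBetti A.X 1, (∀ y, polarizationPairingOne A.X h (A.dim - 1) x y = 0) → x = 0)
    (hψC : pullbackOne A ψ ∈ centralizerAlgebra A) (hRm : R.Monic) (hRirr : Irreducible (R.map (Int.castRingHom ℚ)))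
    (hR0 : R.eval 0 ≠ 0)
    (hψR : Polynomial.eval₂ (Int.castRingHom (CategoryTheory.End A)) (ψ : CategoryTheory.End A) R = 0)
    (hskew : ∀ x y : complexBetti A.X 1, polarizationPairingOne A.X h (A.dim - 1) (pullbackOne A ψ x) y =
      -polarizationPairingOne A.X h (A.dim - 1) x (pullbackOne A ψ y))
    (hF : pullbackOne A φ ∈ Algebra.adjoin ℂ ({pullbackOne A ψ} : Set (Module.End ℂ (complexBetti A.X 1)))) :
    weilClassesField A φ P (2 * m) ⊓ divisorClassesSpan A.X A.dim m = ⊥ ↔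
      ∃ ρ σ : ℂ, Polynomial.eval₂ (Int.castRingHom ℂ) ρ P = 0 ∧
        Module.finrank ℂ ↥((pullbackOne A φ).eigenspace ρ ⊓ (pullbackOne A ψ).eigenspace σ) ≠
          Module.finrank ℂ ↥((pullbackOne A φ).eigenspace ρ ⊓ (pullbackOne A ψ).eigenspace (-σ)) := by
  have hneg : pullbackOne A (-ψ) = -pullbackOne A ψ := pullbackOne_neg_eq_neg ψ
  have hψ' : pullbackOne A (-ψ) ∈ Algebra.adjoin ℂ ({pullbackOne A ψ} : Set (Module.End ℂ (complexBetti A.X 1))) := by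
    rw [hneg]
    exact Subalgebra.neg_mem _ (Algebra.self_mem_adjoin_singleton ℂ _)
  have hadj : ∀ x y : complexBetti A.X 1, polarizationPairingOne A.X h (A.dim - 1) (pullbackOne A ψ x) y =
      polarizationPairingOne A.X h (A.dim - 1) x (pullbackOne A (-ψ) y) := fun x y ↦ by
    rw [hneg, LinearMap.neg_apply, map_neg]
    exact hskew x y
  have hCM : ∀ σ : ℂ, (pullbackOne A ψ).eigenspace σ ⊓ (pullbackOne A (-ψ)).eigenspace σ = ⊥ := fun σ ↦ by
    rw [hneg]
    exact inf_eigenspace_neg_eq_bot_of_aeval_eq_zero hR0 (aeval_hom_complexBetti_map_one_eq_zero hψR) σ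
  rw [weilClassesField_inf_divisorClassesSpan_eq_bot_iff_exists_finrank_ne_of_central hPm hPe hPirr hφ her hm hh hnd hψC
    hRm hRirr hψR hψ' hadj hCM hF]
  refine exists_congr fun ρ ↦ exists_congr fun σ ↦ and_congr Iff.rfl ?_
  rw [hneg, eigenspace_neg_eq_eigenspace_neg]

end Skew

section SkewPowers

variable {A : AbelianVariety ℂ} {h : complexBetti A.X 2} {n : ℕ} {ψ : A ⟶ A}
  {φ : ⨁ (fun _ : Fin (n + 1) => A) ⟶ ⨁ (fun _ : Fin (n + 1) => A)} {P R : Polynomial ℤ} {e m : ℕ}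

/-- **«`W_F` decomposable ⟺ the spectrum of `(⊕ψ)^*` on every `V_ρ` is symmetric», `X = A^{n+1}`, `F ⊆ M_{n+1}(E)`** —
Criterion (2), type 4 with `d = 1`, `m ≥ 1`, for a central skew generator `ψ` of `E` (`ψ† = -ψ`, `R(ψ) = 0` irreducible,
`R(0) ≠ 0`), entries `ιₐ ≫ φ ≫ π_b = p_{ab}(ψ)`, product polarization, `m ≠ 0` — all hypotheses in `End(A)` and on `h`.
[cite: MoonenZarhin1998WeilClasses, §1 Criterion (2) and its proof (chunk p0003 L46–L80)] [cite: Milne1999LefschetzClasses, §1 p. 643, Thm. 3.2, Cor. 4.5] -/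
theorem weilClassesField_biproduct_le_divisorClassesSpan_iff_forall_finrank_eq_of_central_skew (hA : 0 < A.dim)
    (hh : h ∈ hodgeClassSpan A.dim A.X 1) (htop : lefschetzPow h (A.dim - 1) 2 h ≠ 0)
    (hnd : ∀ x : complexBetti A.X 1, (∀ y, polarizationPairingOne A.X h (A.dim - 1) x y = 0) → x = 0)
    (hψ : ∀ χ : A ⟶ A, ψ ≫ χ = χ ≫ ψ) (hRm : R.Monic) (hRirr : Irreducible (R.map (Int.castRingHom ℚ)))
    (hR0 : R.eval 0 ≠ 0)
    (hψR : Polynomial.eval₂ (Int.castRingHom (CategoryTheory.End A)) (ψ : CategoryTheory.End A) R = 0)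
    (hskew : ∀ x y : complexBetti A.X 1, polarizationPairingOne A.X h (A.dim - 1) (pullbackOne A ψ x) y =
      -polarizationPairingOne A.X h (A.dim - 1) x (pullbackOne A ψ y))
    (hPm : P.Monic) (hPe : P.natDegree = e) (hPirr : Irreducible (P.map (Int.castRingHom ℚ)))
    (hφ : Polynomial.eval₂ (Int.castRingHom (CategoryTheory.End (⨁ (fun _ : Fin (n + 1) => A))))
      (φ : CategoryTheory.End (⨁ (fun _ : Fin (n + 1) => A))) P = 0)
    (her : e * (2 * m) = 2 * ((n + 1) * A.dim)) (hm : m ≠ 0) (p : Fin (n + 1) → Fin (n + 1) → Polynomial ℤ)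
    (hφp : ∀ a b, biproduct.ι (fun _ : Fin (n + 1) => A) a ≫ φ ≫ biproduct.π (fun _ : Fin (n + 1) => A) b =
      Polynomial.eval₂ (Int.castRingHom (CategoryTheory.End A)) (ψ : CategoryTheory.End A) (p a b)) :
    weilClassesField (⨁ (fun _ : Fin (n + 1) => A)) φ P (2 * m) ≤
        divisorClassesSpan (⨁ (fun _ : Fin (n + 1) => A)).X (⨁ (fun _ : Fin (n + 1) => A)).dim m ↔
      ∀ ρ : ℂ, Polynomial.eval₂ (Int.castRingHom ℂ) ρ P = 0 → ∀ σ : ℂ,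
        Module.finrank ℂ ↥((pullbackOne (⨁ (fun _ : Fin (n + 1) => A)) φ).eigenspace ρ ⊓
          (pullbackOne (⨁ (fun _ : Fin (n + 1) => A)) (biproduct.map fun _ : Fin (n + 1) => ψ)).eigenspace σ) =
        Module.finrank ℂ ↥((pullbackOne (⨁ (fun _ : Fin (n + 1) => A)) φ).eigenspace ρ ⊓
          (pullbackOne (⨁ (fun _ : Fin (n + 1) => A)) (biproduct.map fun _ : Fin (n + 1) => ψ)).eigenspace (-σ)) := by
  have hneg : pullbackOne A (-ψ) = -pullbackOne A ψ := pullbackOne_neg_eq_neg ψ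
  have hψ' : pullbackOne A (-ψ) ∈ Algebra.adjoin ℂ ({pullbackOne A ψ} : Set (Module.End ℂ (complexBetti A.X 1))) := by
    rw [hneg]
    exact Subalgebra.neg_mem _ (Algebra.self_mem_adjoin_singleton ℂ _)
  have hadj : ∀ x y : complexBetti A.X 1, polarizationPairingOne A.X h (A.dim - 1) (pullbackOne A ψ x) y =
      polarizationPairingOne A.X h (A.dim - 1) x (pullbackOne A (-ψ) y) := fun x y ↦ by
    rw [hneg, LinearMap.neg_apply, map_neg]
    exact hskew x y
  have hCM : ∀ σ : ℂ, (pullbackOne A ψ).eigenspace σ ⊓ (pullbackOne A (-ψ)).eigenspace σ = ⊥ := fun σ ↦ by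
    rw [hneg]
    exact inf_eigenspace_neg_eq_bot_of_aeval_eq_zero hR0 (aeval_hom_complexBetti_map_one_eq_zero hψR) σ
  rw [weilClassesField_biproduct_le_divisorClassesSpan_iff_forall_finrank_eq_of_central hA hh htop hnd hψ hRm hRirr hψR hψ'
    hadj hCM hPm hPe hPirr hφ her hm p hφp]
  refine forall_congr' fun ρ ↦ forall_congr' fun _ ↦ forall_congr' fun σ ↦ ?_
  rw [pullbackOne_biproductMap_const_neg, eigenspace_neg_eq_eigenspace_neg]

/-- **«all non-zero classes exceptional ⟺ the spectrum of `(⊕ψ)^*` on some `V_ρ` is asymmetric», `X = A^{n+1}`**, skew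
form. [cite: MoonenZarhin1998WeilClasses, §1 Criterion (2) and its proof (chunk p0003 L46–L80)] [cite: Milne1999LefschetzClasses, §1 p. 643, Thm. 3.2, Cor. 4.5] -/
theorem weilClassesField_biproduct_inf_divisorClassesSpan_eq_bot_iff_exists_finrank_ne_of_central_skew (hA : 0 < A.dim)
    (hh : h ∈ hodgeClassSpan A.dim A.X 1) (htop : lefschetzPow h (A.dim - 1) 2 h ≠ 0)
    (hnd : ∀ x : complexBetti A.X 1, (∀ y, polarizationPairingOne A.X h (A.dim - 1) x y = 0) → x = 0)
    (hψ : ∀ χ : A ⟶ A, ψ ≫ χ = χ ≫ ψ) (hRm : R.Monic) (hRirr : Irreducible (R.map (Int.castRingHom ℚ)))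
    (hR0 : R.eval 0 ≠ 0)
    (hψR : Polynomial.eval₂ (Int.castRingHom (CategoryTheory.End A)) (ψ : CategoryTheory.End A) R = 0)
    (hskew : ∀ x y : complexBetti A.X 1, polarizationPairingOne A.X h (A.dim - 1) (pullbackOne A ψ x) y =
      -polarizationPairingOne A.X h (A.dim - 1) x (pullbackOne A ψ y))
    (hPm : P.Monic) (hPe : P.natDegree = e) (hPirr : Irreducible (P.map (Int.castRingHom ℚ)))
    (hφ : Polynomial.eval₂ (Int.castRingHom (CategoryTheory.End (⨁ (fun _ : Fin (n + 1) => A))))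
      (φ : CategoryTheory.End (⨁ (fun _ : Fin (n + 1) => A))) P = 0)
    (her : e * (2 * m) = 2 * ((n + 1) * A.dim)) (hm : m ≠ 0) (p : Fin (n + 1) → Fin (n + 1) → Polynomial ℤ)
    (hφp : ∀ a b, biproduct.ι (fun _ : Fin (n + 1) => A) a ≫ φ ≫ biproduct.π (fun _ : Fin (n + 1) => A) b =
      Polynomial.eval₂ (Int.castRingHom (CategoryTheory.End A)) (ψ : CategoryTheory.End A) (p a b)) :
    weilClassesField (⨁ (fun _ : Fin (n + 1) => A)) φ P (2 * m) ⊓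
        divisorClassesSpan (⨁ (fun _ : Fin (n + 1) => A)).X (⨁ (fun _ : Fin (n + 1) => A)).dim m = ⊥ ↔
      ∃ ρ σ : ℂ, Polynomial.eval₂ (Int.castRingHom ℂ) ρ P = 0 ∧
        Module.finrank ℂ ↥((pullbackOne (⨁ (fun _ : Fin (n + 1) => A)) φ).eigenspace ρ ⊓
          (pullbackOne (⨁ (fun _ : Fin (n + 1) => A)) (biproduct.map fun _ : Fin (n + 1) => ψ)).eigenspace σ) ≠
        Module.finrank ℂ ↥((pullbackOne (⨁ (fun _ : Fin (n + 1) => A)) φ).eigenspace ρ ⊓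
          (pullbackOne (⨁ (fun _ : Fin (n + 1) => A)) (biproduct.map fun _ : Fin (n + 1) => ψ)).eigenspace (-σ)) := by
  have hneg : pullbackOne A (-ψ) = -pullbackOne A ψ := pullbackOne_neg_eq_neg ψ
  have hψ' : pullbackOne A (-ψ) ∈ Algebra.adjoin ℂ ({pullbackOne A ψ} : Set (Module.End ℂ (complexBetti A.X 1))) := by
    rw [hneg]
    exact Subalgebra.neg_mem _ (Algebra.self_mem_adjoin_singleton ℂ _)
  have hadj : ∀ x y : complexBetti A.X 1, polarizationPairingOne A.X h (A.dim - 1) (pullbackOne A ψ x) y =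
      polarizationPairingOne A.X h (A.dim - 1) x (pullbackOne A (-ψ) y) := fun x y ↦ by
    rw [hneg, LinearMap.neg_apply, map_neg]
    exact hskew x y
  have hCM : ∀ σ : ℂ, (pullbackOne A ψ).eigenspace σ ⊓ (pullbackOne A (-ψ)).eigenspace σ = ⊥ := fun σ ↦ by
    rw [hneg]
    exact inf_eigenspace_neg_eq_bot_of_aeval_eq_zero hR0 (aeval_hom_complexBetti_map_one_eq_zero hψR) σ
  rw [weilClassesField_biproduct_inf_divisorClassesSpan_eq_bot_iff_exists_finrank_ne_of_central hA hh htop hnd hψ hRm hRirr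
    hψR hψ' hadj hCM hPm hPe hPirr hφ her hm p hφp]
  refine exists_congr fun ρ ↦ exists_congr fun σ ↦ and_congr Iff.rfl ?_
  rw [pullbackOne_biproductMap_const_neg, eigenspace_neg_eq_eigenspace_neg]

end SkewPowers

end Literature.AlgebraicGeometry.HodgeTheory

end
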